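import Summits.HodgeConjecture.CorCM.GaloisCyclicTimesFourIndexTwoDegenerate
import Summits.HodgeConjecture.CorCM.GaloisQuotientNonCentralInvolution
import HarnessLib

/-!
# Lemmas for the descent step of the `2`-power classification: commuting pairs of index two, involutions of cyclic
# `2`-groups, and the LIFTED DICYCLIC RELATIONS kill

COR-CM (cell `pub-hodgecm2`), binder seat b04 (gen 35), count-neutral own lane «Galois-CM-type classification».  KERNEL ONLY:
theorems; no definition, no named fact, no `sorry`.  `HC_CM` is neither used nor claimed.  Tools for
`CorCM/GaloisTwoPowerOrderFourDescent` (same session; A7-JUNCTION gen-34 §E task (R2) «GOOD ⟹ (H2)»).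

* §1 (Mathlib only) `card_closure_pair_le`, **`index_closure_pair_eq_two`** — commuting `a, y` with `⟨a⟩ ∩ ⟨y⟩ = 1` in a finite
  group of order `2 · orderOf a · orderOf y` generate a subgroup of index `2` (the index hypothesis of gen 34's
  `CorCM/GaloisCyclicTimesFourIndexTwoDegenerate`); `eq_halfpower_of_mem_zpowers`, `involution_eq_of_mem_zpowers` — a cyclic group
  `⟨g⟩` with `orderOf g = 2^m` has at most one involution, `g^(2^(m-1))`.
* §2 **`exists_simple_degenerate_of_dicyclic_lift`** — `K` Galois CM of degree `≥ 104`; `t = y²` a central involution other than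
  complex conjugation `c`; `a` with `a⁴ ≠ 1` and `a y a⁻¹ = t y`; `x` with `x² ∈ {c, t c}`, `x a x⁻¹ ∈ {a⁻¹, t a⁻¹}`,
  `x y x⁻¹ ∈ {y, t y}` (these are the relations satisfied by lifts `a, x` of index-two data of a generalised quaternion subgroup
  of the CM quotient `Gal/⟨t⟩` together with an (H2)-violator `y` NOT commuting with `a`).  Then `K` is BAD: one of
  `w ∈ {x, x a, x y, x a y}` has `w² = t c` while `a w a⁻¹ w⁻¹ ∈ {a², a² t}` misses `{1, t c}` (as `a⁴ ≠ 1`), i.e. `w ⟨tc⟩` is a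
  NON-CENTRAL INVOLUTION of the CM quotient `Gal/⟨t c⟩` (order `≥ 52`) — gen 34's quotient criterion
  (`CorCM/GaloisQuotientNonCentralInvolution`).  GOOD form **`mul_comm_of_dicyclic_lift`**: in a GOOD field such `a` and `y` commute.

## References

* [Shimura1998] G. Shimura, *Abelian Varieties with Complex Multiplication and Modular Functions*, §6.2 Thm. 3, §8.2 Prop. 26, §32.10.
* [Kubota1965] T. Kubota, *On the field extension by complex multiplication*, Trans. AMS 118 (1965), §2 and §4 Lemma 2.
* [Gordon1999HodgeAVSurvey] B. B. Gordon, *A survey of the Hodge conjecture for abelian varieties*, Thm. 6.4, §9.3.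
-/

noncomputable section

open CategoryTheory CategoryTheory.Limits NumberField
open scoped BigOperators

namespace Summit.HodgeConjecture.CorCM.GaloisModels

open Literature.NumberTheory.ComplexMultiplication
open Literature.AlgebraicGeometry.Motives (AbelianVariety CMType)
open Literature.AlgebraicGeometry.HodgeTheory
open Literature.AlgebraicGeometry.ComplexMultiplication (IsCMTypeRealisation)
open Literature.AlgebraicGeometry.Pohlmann1968
open Literature.Barriers.HodgeConjecture (divisorClassesSpan)
open Summit.HodgeConjecture.CorCM.GaloisRank

/-! ## §1 Group lemmas -/

section Group

variable {G : Type*} [Group G] {a y : G}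

/-- For commuting `a, y`: `|closure {a, y}| ≤ orderOf a · orderOf y` (every element is `aⁱ yʲ`). [folklore] -/
theorem card_closure_pair_le [Finite G] (hay : a * y = y * a) :
    Nat.card (Subgroup.closure ({a, y} : Set G)) ≤ orderOf a * orderOf y := by
  classical
  set A := Subgroup.closure ({a, y} : Set G)
  have haA : a ∈ A := Subgroup.subset_closure (by simp)
  have hyA : y ∈ A := Subgroup.subset_closure (by simp)
  rw [← Nat.card_zpowers, ← Nat.card_zpowers, ← Nat.card_prod]
  let f : Subgroup.zpowers a × Subgroup.zpowers y → A := fun p =>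
    ⟨p.1 * p.2, A.mul_mem ((Subgroup.zpowers_le.2 haA) p.1.2) ((Subgroup.zpowers_le.2 hyA) p.2.2)⟩
  refine Nat.card_le_card_of_surjective f fun u => ?_
  obtain ⟨i, j, hij⟩ := CyclicTimesFour.exists_eq_zpow_mul_zpow hay u.2
  refine ⟨⟨⟨a ^ i, Subgroup.zpow_mem _ (Subgroup.mem_zpowers a) i⟩, ⟨y ^ j, Subgroup.zpow_mem _ (Subgroup.mem_zpowers y) j⟩⟩,
    Subtype.ext ?_⟩
  exact hij.symm

/-- Commuting `a, y` with `⟨a⟩ ∩ ⟨y⟩ = 1` in a group of order `2 · orderOf a · orderOf y` generate a subgroup of index `2`.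
[folklore] -/
theorem index_closure_pair_eq_two [Finite G] (hay : a * y = y * a)
    (hint : ∀ g : G, g ∈ Subgroup.zpowers a → g ∈ Subgroup.zpowers y → g = 1)
    (hcard : Nat.card G = 2 * (orderOf a * orderOf y)) :
    (Subgroup.closure ({a, y} : Set G)).index = 2 := by
  have h1 := card_closure_pair_le hay
  have h2 := CyclicTimesFour.mul_card_le_card_closure hint
  have h3 : Nat.card (Subgroup.closure ({a, y} : Set G)) = orderOf a * orderOf y := le_antisymm h1 h2
  have h4 := (Subgroup.closure ({a, y} : Set G)).index_mul_card
  rw [h3, hcard] at h4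
  have hpos : 0 < orderOf a * orderOf y := Nat.mul_pos (orderOf_pos a) (orderOf_pos y)
  exact Nat.eq_of_mul_eq_mul_right hpos h4

/-- The involution of a cyclic `2`-group: `orderOf g = 2^m`, `s ∈ ⟨g⟩`, `s² = 1 ≠ s` ⟹ `1 ≤ m` and `s = g^(2^(m-1))`. [folklore] -/
theorem eq_halfpower_of_mem_zpowers {g s : G} {m : ℕ} (hg : orderOf g = 2 ^ m) (hs : s ∈ Subgroup.zpowers g)
    (hss : s * s = 1) (hs1 : s ≠ 1) : 1 ≤ m ∧ s = g ^ ((2 : ℤ) ^ (m - 1)) := by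
  have hm : 1 ≤ m := by
    by_contra h
    have hm0 : m = 0 := by omega
    rw [hm0, pow_zero, orderOf_eq_one_iff] at hg
    rw [hg, Subgroup.zpowers_one_eq_bot, Subgroup.mem_bot] at hs
    exact hs1 hs
  refine ⟨hm, ?_⟩
  rw [Subgroup.mem_zpowers_iff] at hs
  obtain ⟨i, rfl⟩ := hs
  rcases CyclicTimesFour.zpow_eq_one_or_eq_halfpower hm hg i (by rw [mul_comm, zpow_mul, zpow_two, hss]) with h | h
  · exact absurd h hs1
  · exact h

/-- Two involutions of a cyclic `2`-group coincide. [folklore] -/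
theorem involution_eq_of_mem_zpowers {g s s' : G} {m : ℕ} (hg : orderOf g = 2 ^ m) (hs : s ∈ Subgroup.zpowers g)
    (hss : s * s = 1) (hs1 : s ≠ 1) (hs' : s' ∈ Subgroup.zpowers g) (hss' : s' * s' = 1) (hs1' : s' ≠ 1) : s = s' := by
  rw [(eq_halfpower_of_mem_zpowers hg hs hss hs1).2, (eq_halfpower_of_mem_zpowers hg hs' hss' hs1').2]

/-- `x^(2^k) ≠ 1`, `x^(2^(k+1)) = 1` ⟹ `orderOf x = 2^(k+1)`. [folklore] -/
theorem orderOf_eq_two_pow_succ {x : G} {k : ℕ} (h1 : x ^ 2 ^ k ≠ 1) (h2 : x ^ 2 ^ (k + 1) = 1) :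
    orderOf x = 2 ^ (k + 1) :=
  orderOf_eq_prime_pow h1 h2

end Group

/-! ## §2 The lifted dicyclic relations -/

section Field

variable {K : Type} [Field K] [NumberField K] [IsCMField K] [IsGalois ℚ K]

/-- **LIFTED DICYCLIC RELATIONS WITH A NON-COMMUTING VIOLATOR ⟹ BAD.**  `K` Galois CM of degree `≥ 104`, `c` = complex
conjugation; `t = y²` a central involution, `t ≠ c`; `a⁴ ≠ 1`, `a y a⁻¹ = t y`; `x² ∈ {c, t c}`, `x a x⁻¹ ∈ {a⁻¹, t a⁻¹}`,
`x y x⁻¹ ∈ {y, t y}`.  Then `K` carries a SIMPLE DEGENERATE abelian variety of dimension `[K:ℚ]/2` with CM by `K` and a rational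
`(p,p)` class outside the divisor ring on some power (one of `x, x a, x y, x a y` is a non-central involution of the CM quotient
`Gal/⟨t c⟩`). [cite: Shimura1998, §6.2 Thm. 3, §8.2 Prop. 26 and §32.10] [cite: Kubota1965, §2 and §4 Lemma 2]
[cite: Gordon1999HodgeAVSurvey, Thm. 6.4 and §9.3] -/
theorem exists_simple_degenerate_of_dicyclic_lift (hdeg : 104 ≤ Module.finrank ℚ K) (a x y t : K ≃ₐ[ℚ] K)
    (ht : t = y * y) (htt : t * t = 1) (ht1 : t ≠ 1) (htc : t ≠ (IsCMField.complexConj K).restrictScalars ℚ)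
    (htcen : ∀ g : K ≃ₐ[ℚ] K, g * t = t * g) (ha4 : a ^ 4 ≠ 1) (hya : a * y * a⁻¹ = t * y)
    (hxx : x * x = (IsCMField.complexConj K).restrictScalars ℚ ∨ x * x = t * (IsCMField.complexConj K).restrictScalars ℚ)
    (hxa : x * a * x⁻¹ = a⁻¹ ∨ x * a * x⁻¹ = t * a⁻¹) (hxy : x * y * x⁻¹ = y ∨ x * y * x⁻¹ = t * y) :
    ∃ (Φ : CMType K) (φ : K →+* ℂ) (X : AbelianVariety ℂ) (ι : 𝓞 K →+* End X)
      (ϑ : K →+* Module.End ℂ (complexBetti X.X 1)),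
      IsPrimitive (ℂ ≃+* ℂ) Φ.1 φ ∧ ¬ IsNondegenerate Φ ∧ IsCMTypeRealisation Φ X ι ϑ ∧ X.IsSimple ∧
      X.dim = Module.finrank ℚ K / 2 ∧
      ∃ m p : ℕ, ∃ z : complexBetti (⨁ fun _ : Fin m => X).X (2 * p), IsRationalClass z ∧
        IsOfHodgeType (⨁ fun _ : Fin m => X).dim (⨁ fun _ : Fin m => X).X (2 * p) p p z ∧
        z ∉ divisorClassesSpan (⨁ fun _ : Fin m => X).X (⨁ fun _ : Fin m => X).dim p := by
  classical
  set c := (IsCMField.complexConj K).restrictScalars ℚ with hc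
  have hcc : c * c = 1 := model_complexConj_mul_self (MulEquiv.refl (K ≃ₐ[ℚ] K)) (by simp [hc])
  have hc1 : c ≠ 1 := model_complexConj_ne_one (MulEquiv.refl (K ≃ₐ[ℚ] K)) (by simp [hc])
  have hccen : ∀ g : K ≃ₐ[ℚ] K, g * c = c * g := fun g =>
    (model_complexConj_comm (MulEquiv.refl (K ≃ₐ[ℚ] K)) (by simp [hc]) g).symm
  have hbig : 104 ≤ Fintype.card (K ≃ₐ[ℚ] K) := by rw [card_model_eq_finrank (MulEquiv.refl (K ≃ₐ[ℚ] K))]; exact hdeg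
  have htcsq : t * c * (t * c) = 1 := by
    calc t * c * (t * c) = t * (c * t) * c := by group
      _ = t * (t * c) * c := by rw [← hccen t]
      _ = (t * t) * (c * c) := by group
      _ = 1 := by rw [htt, hcc, one_mul]
  have htc1' : t * c ≠ 1 := by
    intro h
    apply htc
    rw [mul_eq_one_iff_eq_inv] at h
    rw [h]
    exact inv_eq_of_mul_eq_one_right hcc
  have htccen : ∀ g : K ≃ₐ[ℚ] K, t * c * g = g * (t * c) := fun g => by
    rw [mul_assoc, ← hccen g, ← mul_assoc, ← htcen g, mul_assoc]
  have hc_tc : (MulEquiv.refl (K ≃ₐ[ℚ] K)) ((IsCMField.complexConj K).restrictScalars ℚ) ≠ t * c := by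
    rw [MulEquiv.refl_apply, ← hc]
    intro h
    have h3 : 1 * c = t * c := by rw [one_mul]; exact h
    exact ht1 (mul_right_cancel h3).symm
  -- `a² ∉ {1, t, c, t c}` since `a⁴ ≠ 1`
  have hsq_ne : ∀ s : K ≃ₐ[ℚ] K, s * s = 1 → a * a ≠ s := by
    intro s hss h'
    exact ha4 (by rw [show (4 : ℕ) = 2 + 2 by norm_num, pow_add, pow_two, h', hss])
  -- the commutator `a x a⁻¹ x⁻¹ ∈ {a², a² t}` and conjugation facts
  have hκx : a * x * a⁻¹ * x⁻¹ = a * a ∨ a * x * a⁻¹ * x⁻¹ = a * a * t := by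
    rcases hxa with h | h
    · left
      calc a * x * a⁻¹ * x⁻¹ = a * (x * a * x⁻¹)⁻¹ := by group
        _ = a * a := by rw [h, inv_inv]
    · right
      calc a * x * a⁻¹ * x⁻¹ = a * (x * a * x⁻¹)⁻¹ := by group
        _ = a * (a * t⁻¹) := by rw [h, mul_inv_rev, inv_inv]
        _ = a * a * t := by rw [inv_eq_of_mul_eq_one_right htt, mul_assoc]
  have hxt : x * t * x⁻¹ = t := by rw [htcen x, mul_inv_cancel_right]
  have hat : a * t * a⁻¹ = t := by rw [htcen a, mul_inv_cancel_right]
  have hya_inv : y * a⁻¹ * y⁻¹ = a⁻¹ * t := by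
    calc y * a⁻¹ * y⁻¹ = a⁻¹ * (a * y * a⁻¹) * y⁻¹ := by group
      _ = a⁻¹ * (t * y) * y⁻¹ := by rw [hya]
      _ = a⁻¹ * t := by group
  -- it suffices to find `w` with `w² = t c` and `a w a⁻¹ w⁻¹ ∈ {a x a⁻¹ x⁻¹, a x a⁻¹ x⁻¹ t}`
  suffices hw : ∃ w : K ≃ₐ[ℚ] K, w * w = t * c ∧
      (a * w * a⁻¹ * w⁻¹ = a * x * a⁻¹ * x⁻¹ ∨ a * w * a⁻¹ * w⁻¹ = a * x * a⁻¹ * x⁻¹ * t) by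
    obtain ⟨w, hww, hw⟩ := hw
    have hv : a * w * a⁻¹ * w⁻¹ = a * a ∨ a * w * a⁻¹ * w⁻¹ = a * a * t := by
      rcases hw with h1 | h1 <;> rcases hκx with h2 | h2
      · exact Or.inl (h1.trans h2)
      · exact Or.inr (h1.trans h2)
      · exact Or.inr (by rw [h1, h2])
      · exact Or.inl (by rw [h1, h2, mul_assoc (a * a), htt, mul_one])
    have hform : a * w * (w * a)⁻¹ = a * w * a⁻¹ * w⁻¹ := by rw [mul_inv_rev, ← mul_assoc]
    refine exists_simple_degenerate_of_noncentral_involution_mod_central (MulEquiv.refl (K ≃ₐ[ℚ] K)) (t * c) htcsq htc1'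
      htccen hc_tc hbig w a (Or.inr hww) ?_ ?_
    · rw [hform]
      rcases hv with hv | hv <;> rw [hv]
      · exact hsq_ne 1 (mul_one 1)
      · intro h
        rw [mul_eq_one_iff_eq_inv, inv_eq_of_mul_eq_one_right htt] at h
        exact hsq_ne t htt h
    · rw [hform]
      rcases hv with hv | hv <;> rw [hv]
      · exact hsq_ne _ htcsq
      · intro h
        rw [hccen t] at h
        exact hsq_ne c hcc (mul_right_cancel h)
  -- the four candidates
  rcases hxx with hxx | hxx
  · rcases hxa with hxa | hxa
    · rcases hxy with hxy | hxy
      · -- `w = x y`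
        have hcxy : x * y = y * x := mul_inv_eq_iff_eq_mul.1 hxy
        refine ⟨x * y, ?_, Or.inr ?_⟩
        · calc x * y * (x * y) = x * (y * x) * y := by group
            _ = x * (x * y) * y := by rw [← hcxy]
            _ = (x * x) * (y * y) := by group
            _ = c * t := by rw [hxx, ← ht]
            _ = t * c := (hccen t).symm
        · calc a * (x * y) * a⁻¹ * (x * y)⁻¹ = a * x * (y * a⁻¹ * y⁻¹) * x⁻¹ := by group
            _ = a * x * (a⁻¹ * t) * x⁻¹ := by rw [hya_inv]
            _ = (a * x * a⁻¹ * x⁻¹) * (x * t * x⁻¹) := by group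
            _ = a * x * a⁻¹ * x⁻¹ * t := by rw [hxt]
      · -- `w = x a y`
        have hu : x * a * y = y * (x * a) := by
          calc x * a * y = (x * (a * y * a⁻¹) * x⁻¹) * (x * a) := by group
            _ = (x * (t * y) * x⁻¹) * (x * a) := by rw [hya]
            _ = ((x * t * x⁻¹) * (x * y * x⁻¹)) * (x * a) := by group
            _ = (t * (t * y)) * (x * a) := by rw [hxt, hxy]
            _ = y * (x * a) := by rw [← mul_assoc t t y, htt, one_mul]
        have huu : x * a * (x * a) = c := by
          calc x * a * (x * a) = (x * a * x⁻¹) * (x * x) * a := by group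
            _ = a⁻¹ * c * a := by rw [hxa, hxx]
            _ = a⁻¹ * (a * c) := by rw [mul_assoc, ← hccen a]
            _ = c := by group
        refine ⟨x * a * y, ?_, Or.inr ?_⟩
        · calc x * a * y * (x * a * y) = (x * a) * (y * (x * a)) * y := by group
            _ = (x * a) * ((x * a) * y) * y := by rw [← hu]
            _ = (x * a * (x * a)) * (y * y) := by group
            _ = c * t := by rw [huu, ← ht]
            _ = t * c := (hccen t).symm
        · calc a * (x * a * y) * a⁻¹ * (x * a * y)⁻¹ = a * x * a * (y * a⁻¹ * y⁻¹) * a⁻¹ * x⁻¹ := by group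
            _ = a * x * a * (a⁻¹ * t) * a⁻¹ * x⁻¹ := by rw [hya_inv]
            _ = (a * x * a⁻¹ * x⁻¹) * (x * (a * t * a⁻¹) * x⁻¹) := by group
            _ = (a * x * a⁻¹ * x⁻¹) * (x * t * x⁻¹) := by rw [hat]
            _ = a * x * a⁻¹ * x⁻¹ * t := by rw [hxt]
    · -- `w = x a`
      refine ⟨x * a, ?_, Or.inl (by group)⟩
      calc x * a * (x * a) = (x * a * x⁻¹) * (x * x) * a := by group
        _ = t * a⁻¹ * c * a := by rw [hxa, hxx]
        _ = t * (a⁻¹ * (c * a)) := by group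
        _ = t * (a⁻¹ * (a * c)) := by rw [← hccen a]
        _ = t * c := by group
  · -- `w = x`
    exact ⟨x, hxx, Or.inl rfl⟩

/-- **GOOD form**: in a Galois CM field of degree `≥ 104` all of whose primitive CM types are nondegenerate, lifts `a, x` of
dicyclic data modulo the central involution `t = y² ≠ c` (`a⁴ ≠ 1`, `x² ∈ {c, tc}`, `x a x⁻¹ ∈ {a⁻¹, t a⁻¹}`, `x y x⁻¹ ∈ {y, t y}`)
with `a y a⁻¹ ∈ {y, t y}` have `a y = y a`. [cite: Shimura1998, §8.2 Prop. 26 and §32.10] -/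
theorem mul_comm_of_dicyclic_lift (hdeg : 104 ≤ Module.finrank ℚ K)
    (hgood : ∀ (Φ : CMType K) (φ : K →+* ℂ), IsPrimitive (ℂ ≃+* ℂ) Φ.1 φ → IsNondegenerate Φ) (a x y t : K ≃ₐ[ℚ] K)
    (ht : t = y * y) (htt : t * t = 1) (ht1 : t ≠ 1) (htc : t ≠ (IsCMField.complexConj K).restrictScalars ℚ)
    (htcen : ∀ g : K ≃ₐ[ℚ] K, g * t = t * g) (ha4 : a ^ 4 ≠ 1) (hya : a * y * a⁻¹ = y ∨ a * y * a⁻¹ = t * y)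
    (hxx : x * x = (IsCMField.complexConj K).restrictScalars ℚ ∨ x * x = t * (IsCMField.complexConj K).restrictScalars ℚ)
    (hxa : x * a * x⁻¹ = a⁻¹ ∨ x * a * x⁻¹ = t * a⁻¹) (hxy : x * y * x⁻¹ = y ∨ x * y * x⁻¹ = t * y) : a * y = y * a := by
  rcases hya with hya | hya
  · exact mul_inv_eq_iff_eq_mul.1 hya
  · obtain ⟨Φ, φ, X, ι, ϑ, H1, H2, -⟩ :=
      exists_simple_degenerate_of_dicyclic_lift hdeg a x y t ht htt ht1 htc htcen ha4 hya hxx hxa hxy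
    exact absurd (hgood Φ φ H1) H2

end Field

end Summit.HodgeConjecture.CorCM.GaloisModels
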